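import Summits.Langlands.Langlands.Theorems.IrreducibilityBySelfDualityPairLBoundaryJSGapGlobalTranslatePart2

/-!
# The gap global theorem in TRANSLATE form for `GL_n × GL_m`, `0 < m < n`, from the analytic clause:
`J(s) = w_s(τ) · L^{S'}(s + (n-m)/2, α ⊗ γ̄) · ∫_{B({v ∉ S'}) × K} W_Φ(diag(T) ι ·) W̄_{Φ'}(diag τ ·) |det|^s δ⁻¹`

Summit `Langlands`, sub-problem `Langlands`, helper file under `Theorems/` supporting the crux
`PairLBoundaryJS` (stmt-Langlands-13622), line `Sketch`, main theorem `exists_entire_eq_translate_of` behind the registered stub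
`stub_gap_global_translate` (G-GT, file `…GapGlobalTranslate.lean`) of the GAP ROAD (skeleton v19, lead c6): the `GL_n × GL_m` analogue of
`CornerGlobalTranslate.stub_corner_global_translate`, `ι = glCorner (m ≤ n) : h ↦ diag(h, 1_{n-m})`.

Everything is at the TORUS parameter `s` of `torusPairIntegrandC` (the printed `Ψ(s + (n-m)/2; W, W')`).
The three inputs are HYPOTHESES of `exists_entire_eq_translate_of` (so that this file lands before its siblings):
(E) the analytic clause of Cogdell (2004), Thm. 2.1 in unfolded form (named fact `stub_gap_entire_fact`); (Ac)
one-factor absolute convergence (`stub_gap_abs_convergence`); (EL) the Euler factorisation over all good places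
(`stub_gap_euler_limit`). Assembly: with `D = diag(1_m, T_m, …, T_{n-1})` (finite-adelic) the right translate
`r(D) φ` is an honest `A_G`-invariant cusp form (`IsCuspFormGL.rightTranslation_gl`) with `W_{r(D)φ}(g) = W_φ(g D)`
(`whittakerCoeff_mul_right`); (E) at `(r(D) φ, φ')` gives the entire `J`; the torus substitution `a ↦ τ a` of part 1
turns `W_{r(D)φ}(ι(ak))` into `W_φ(diag(T) ι(ak))` (`ι(diag τ) D = diag T`, `D ι(g) = ι(g) D`); then the honest
translated unramified data (`HonestTranslateUnramified.…_translate` at `GL_n` and `GL_m`), the Satake bounds, the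
central character of `π`, (Ac) at `r(D) φ`, (EL) and `hasProd_partialPairL` at `s + (n-m)/2`, exactly as in
`CornerGlobalTranslate.jpssIntegral_star_eq`.

## References

* J. W. Cogdell, *Analytic theory of L-functions for GL_n*, in *An Introduction to the Langlands
  Program* (2004), §2.2 (PDF pp. 182–184), Thm. 2.1–2.2, §3.1 Thm. 3.3, §4.2 [CogdellAnalyticTheory2004].
* H. Jacquet, I. I. Piatetski-Shapiro, J. Shalika, *Rankin–Selberg convolutions*, Amer. J. Math.
  105 (1983), §2 [JacquetPiatetskiShapiroShalika1983].
-/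

noncomputable section

-- `Summit.Langlands.Langlands.…` (summit = sub-problem name, D-0017 layout) trips `dupNamespace`
set_option linter.dupNamespace false

open scoped MatrixGroups Topology Pointwise ENNReal NNReal ComplexConjugate InnerProductSpace ContDiff
open scoped Classical Matrix.Norms.Operator
open NumberField IsDedekindDomain MeasureTheory Measure Matrix Set Filter WithZero
open NumberField.mixedEmbedding
open Literature.NumberTheory.Automorphic AdelicGroupData
open Literature.NumberTheory.GaloisRepresentations (ideleGroup HeckeCharacter)
open Literature.MeasureTheory.Group
open Literature.RingTheory.SymmetricFunctions.SymmPoly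
open ValuativeRel

-- the automorphic quotient carries the tree's Borel σ-algebra, not Mathlib's quotient σ-algebra
attribute [-instance] Quotient.instMeasurableSpace QuotientGroup.measurableSpace

-- the house local instances, exactly as in `RankinSelbergUnfoldingIdentity`
attribute [local instance] adelicBorel borelSpace_adelic locallyCompactSpace_adelic secondCountableTopology_gl_adelic
  glAdeleBorel borelSpace_glAdele borelSpace_ideleGroup secondCountableTopology_ideleGroup

attribute [local instance 100] LieRing.ofAssociativeRing

namespace Summit.Langlands.Langlands.Theorems.GapGlobalTranslate

open GapGlobalTranslatePart1 GapGlobalTranslatePart2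

/-! ### The gap global theorem in translate form, from the analytic clause -/

section Main

variable {n m : ℕ} {K : Type} [Field K] [NumberField K]
  [MeasurableSpace (AdeleRing (𝓞 K) K)] [BorelSpace (AdeleRing (𝓞 K) K)]

local notation "𝔸" => AdeleRing (𝓞 K) K

omit [MeasurableSpace (AdeleRing (𝓞 K) K)] [BorelSpace (AdeleRing (𝓞 K) K)] in
/-- **A torus element trivial at infinity has entries trivial at infinity**: if `diag(T)_∞ = 1` then
`(T_i)_∞ = 1` for every `i`. [folklore] -/
theorem fst_apply_eq_one_of_toMixed_glDiagonal (T : Fin n → ideleGroup K)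
    (hTinf : GLn.toMixed n K (glDiagonal n 𝔸 T) = 1) (i : Fin n) : ((T i : ideleGroup K) : 𝔸).1 = 1 := by
  have h1 : GLn.fstHom n K (glDiagonal n 𝔸 T) = 1 := by
    rw [GLn.toMixed_apply] at hTinf
    exact (MulEquiv.map_eq_one_iff _).1 hTinf
  have h2 : (((glDiagonal n 𝔸 T : GL (Fin n) 𝔸) : Matrix (Fin n) (Fin n) 𝔸) i i).1 =
      (1 : Matrix (Fin n) (Fin n) (InfiniteAdeleRing K)) i i :=
    congrFun (congrFun (congrArg (fun u : GL (Fin n) (InfiniteAdeleRing K) =>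
      (u : Matrix (Fin n) (Fin n) (InfiniteAdeleRing K))) h1) i) i
  rw [coe_glDiagonal, Matrix.diagonal_apply_eq, Matrix.one_apply_eq] at h2
  exact h2

omit [MeasurableSpace (AdeleRing (𝓞 K) K)] [BorelSpace (AdeleRing (𝓞 K) K)] in
/-- **A torus element with entries trivial at infinity is finite-adelic**: `diag(D) = (1, diag(D_f))` lies in the
image of `GL_n(𝔸_K^∞)`. [folklore] -/
theorem glDiagonal_mem_range_ofFinite (D : Fin n → ideleGroup K) (hD : ∀ i, ((D i : ideleGroup K) : 𝔸).1 = 1) :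
    glDiagonal n 𝔸 D ∈ (GLn.ofFinite n K).range := by
  refine ⟨glDiagonal n (FiniteAdeleRing (𝓞 K) K) fun i =>
    Units.map (RingHom.snd (InfiniteAdeleRing K) (FiniteAdeleRing (𝓞 K) K)).toMonoidHom (D i), ?_⟩
  refine Matrix.GeneralLinearGroup.ext fun a b => ?_
  rw [GLn.coe_ofFinite_apply, coe_glDiagonal, coe_glDiagonal, Matrix.diagonal_apply, Matrix.diagonal_apply,
    Matrix.one_apply]
  by_cases hab : a = b
  · subst hab
    rw [if_pos rfl, if_pos rfl, if_pos rfl]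
    exact Prod.ext (hD a).symm rfl
  · rw [if_neg hab, if_neg hab, if_neg hab]
    rfl

omit [MeasurableSpace (AdeleRing (𝓞 K) K)] [BorelSpace (AdeleRing (𝓞 K) K)] in
/-- **SUB-STUB (G-GT, torus bookkeeping)** — (i) a torus element trivial at infinity has entries trivial at
infinity; (ii) a torus element with entries trivial at infinity is finite-adelic. [folklore] -/
theorem stub_gap_diag_finite :
    ∀ {n : ℕ} {K : Type} [Field K] [NumberField K] (T : Fin n → ideleGroup K),
    (GLn.toMixed n K (glDiagonal n (AdeleRing (𝓞 K) K) T) = 1 →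
      ∀ i : Fin n, ((T i : ideleGroup K) : AdeleRing (𝓞 K) K).1 = 1) ∧
    ((∀ i : Fin n, ((T i : ideleGroup K) : AdeleRing (𝓞 K) K).1 = 1) →
      glDiagonal n (AdeleRing (𝓞 K) K) T ∈ (GLn.ofFinite n K).range) := by
  intro n' K' _ _ T
  exact ⟨fst_apply_eq_one_of_toMixed_glDiagonal T, glDiagonal_mem_range_ofFinite T⟩

/-- **The gap global theorem in translate form at the torus parameter, GRANTED (E), (Ac), (EL)** (Cogdell
(2004), Thm. 2.1–2.2, §3.1 Thm. 3.3, §4.2; JPSS (1983), §2). For `0 < m < n`, Haar measures, cuspidal `π` on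
`GL_n(𝔸_K)`, `σ` on `GL_m(𝔸_K)` with Satake families `α`, `γ` off `S`, honest continuous representatives `Φ`,
`Φ'` of `sv ∈ π`, `sv' ∈ σ`, right `K(𝔫₀)`-invariant, `S' ⊇ S` off which `v ∤ 𝔫₀`, torus elements `τ`, `T`
(`T_i = τ_i` for `i < m`, `T` trivial at infinity) correcting the conductor of Tate's character off `S'` in
every simple root, and enumerations `x`, `y` of `α`, `γ` off `S'`: there are `x₀` and an ENTIRE `J` with
`J(s) = w_s(τ) · L^{S'}(s + (n-m)/2, α ⊗ γ̄) · ∫_{B({v ∉ S'}) × K} I^{T,τ}_s` for `re s > x₀`. The hypotheses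
`hE`, `hAbs`, `hEul` are the analytic clause (at the given measures), the one-factor absolute convergence and
the Euler factorisation over all good places. [cite: CogdellAnalyticTheory2004, §2.2 Thm. 2.1–2.2, §3.1 Thm. 3.3, §4.2] -/
theorem exists_entire_eq_translate_of (hm : 0 < m) (hmn : m < n)
    (μ : Measure (AdelicGroupData.gl n K).automorphicQuotient)
    [(AdelicGroupData.gl n K).IsAutomorphicMeasure μ]
    (μ' : Measure (AdelicGroupData.gl m K).automorphicQuotient) [(AdelicGroupData.gl m K).IsAutomorphicMeasure μ']
    (νA : Measure (Fin m → ideleGroup K)) [IsHaarMeasure νA]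
    (νK : Measure ↥(maximalCompactAdelic m K)) [IsHaarMeasure νK]
    (ν₀ : Measure ↥(adelicUnipotent n K)) [IsHaarMeasure ν₀]
    (ν₀' : Measure ↥(adelicUnipotent m K)) [IsHaarMeasure ν₀']
    (hE : ∀ {φ : GL (Fin n) 𝔸 → ℂ} {φ' : GL (Fin m) 𝔸 → ℂ},
      IsCuspFormGL n K (isCompact_glFiniteIntegralLevel_holds n K) φ →
      IsCuspFormGL m K (isCompact_glFiniteIntegralLevel_holds m K) φ' →
      (∀ z ∈ (AdelicGroupData.gl n K).center', ∀ g : (AdelicGroupData.gl n K).Adelic, φ (z * g) = φ g) →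
      (∀ z ∈ (AdelicGroupData.gl m K).center', ∀ g : (AdelicGroupData.gl m K).Adelic, φ' (z * g) = φ' g) →
      ∃ (x₀ : ℝ) (J : ℂ → ℂ), Differentiable ℂ J ∧ ∀ s : ℂ, x₀ < s.re →
        J s = ∫ p, torusPairIntegrandC m K
          (fun g => whittakerCoeff ν₀ (unipotentTateDomain n K) (adeleAddChar K) φ (glCorner 𝔸 hmn.le g))
          (fun g => star (whittakerCoeff ν₀' (unipotentTateDomain m K) (adeleAddChar K) φ' g))
          (fun _ => (1 : ℝ)) s p ∂(νA.prod νK))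
    (hAbs : ∀ {φ : GL (Fin n) 𝔸 → ℂ},
      IsCuspFormGL n K (isCompact_glFiniteIntegralLevel_holds n K) φ →
      (∀ z ∈ (AdelicGroupData.gl n K).center', ∀ g : (AdelicGroupData.gl n K).Adelic, φ (z * g) = φ g) →
      ∃ σ₀ : ℝ, ∀ σ : ℝ, σ₀ ≤ σ →
        ∫⁻ p, ‖whittakerDepth 0 φ (glCorner 𝔸 hmn.le (torusPoint m K p))‖ₑ *
            ENNReal.ofReal (torusWeight m K σ p.1) ∂(νA.prod νK) < ⊤)
    (hEul : ∀ {W : GL (Fin n) 𝔸 → ℂ} {W' : GL (Fin m) 𝔸 → ℂ},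
      Continuous W → Continuous W' →
      (∀ (z : ideleGroup K) (g : GL (Fin n) 𝔸), ‖W (Matrix.GeneralLinearGroup.scalar (Fin n) z * g)‖ = ‖W g‖) →
      ∀ {S' : Set (HeightOneSpectrum (𝓞 K))}
        {ϖ : ∀ v : HeightOneSpectrum (𝓞 K), (v.adicCompletion K)ˣ}
        {x : HeightOneSpectrum (𝓞 K) → Fin n → ℂ} {y : HeightOneSpectrum (𝓞 K) → Fin m → ℂ},
      (∀ v ∉ S', IsTorusUnramifiedAt n K W v (ϖ v) (x v)) →
      (∀ v ∉ S', IsTorusUnramifiedAt m K W' v (ϖ v) (y v)) →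
      (∀ v ∉ S', ∀ i, ‖x v i‖ ≤ (v.residueCard : ℝ) ^ (1 / 2 : ℝ)) →
      (∀ v ∉ S', ∀ a, ‖y v a‖ ≤ (v.residueCard : ℝ) ^ (1 / 2 : ℝ)) →
      ∀ (s : ℂ), 1 / 2 < s.re →
      Integrable (torusPairIntegrandC m K (fun g => W (glCorner 𝔸 hmn.le g)) W' (fun _ => (1 : ℝ)) s) (νA.prod νK) →
      ∀ {α β : HeightOneSpectrum (𝓞 K) → Multiset ℂ},
      (∀ v ∉ S', (Finset.univ : Finset (Fin n)).val.map (x v) = α v) →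
      (∀ v ∉ S', (Finset.univ : Finset (Fin m)).val.map (y v) = β v) →
      ∀ {L : ℂ}, HasProd (fun u : {v : HeightOneSpectrum (𝓞 K) // v ∉ S'} =>
        ((satakePairPolynomial (α u.1) (β u.1)).eval
          ((u.1.residueCard : ℂ) ^ (-(s + ((n : ℂ) - (m : ℂ)) / 2))))⁻¹) L →
      ∫ p, torusPairIntegrandC m K (fun g => W (glCorner 𝔸 hmn.le g)) W' (fun _ => (1 : ℝ)) s p ∂(νA.prod νK) =
        L * ∫ p in unitBox {v | v ∉ S'} ×ˢ Set.univ, torusPairIntegrandC m K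
          (fun g => W (glCorner 𝔸 hmn.le g)) W' (fun _ => (1 : ℝ)) s p ∂(νA.prod νK))
    (P : CuspidalAutomorphicRepGL n K μ) (Q : CuspidalAutomorphicRepGL m K μ')
    {S : Set (HeightOneSpectrum (𝓞 K))} {α γ : SatakeFamily K}
    (hα : IsSatakeFamilyOf P S α) (hγ : IsSatakeFamilyOf Q S γ)
    {Φ : (AdelicGroupData.gl n K).automorphicQuotient → ℂ}
    {Φ' : (AdelicGroupData.gl m K).automorphicQuotient → ℂ} (hΦc : Continuous Φ) (hΦ'c : Continuous Φ')
    (sv : P.1.toSubmodule) (sv' : Q.1.toSubmodule)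
    (hae : ((sv : (AdelicGroupData.gl n K).L2 μ) : (AdelicGroupData.gl n K).automorphicQuotient → ℂ) =ᵐ[μ] Φ)
    (hae' : ((sv' : (AdelicGroupData.gl m K).L2 μ') : (AdelicGroupData.gl m K).automorphicQuotient → ℂ) =ᵐ[μ'] Φ')
    (hcusp : IsCuspFormGL n K (isCompact_glFiniteIntegralLevel_holds n K) (invQuot (AdelicGroupData.gl n K) Φ))
    (hcusp' : IsCuspFormGL m K (isCompact_glFiniteIntegralLevel_holds m K) (invQuot (AdelicGroupData.gl m K) Φ'))
    {𝔫₀ : Ideal (𝓞 K)} (h𝔫₀ : 𝔫₀ ≠ 0)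
    (hΦU : ∀ k ∈ principalCongruenceLevel n K 𝔫₀, ∀ y : GL (Fin n) 𝔸,
      invQuot (AdelicGroupData.gl n K) Φ (y * k) = invQuot (AdelicGroupData.gl n K) Φ y)
    (hΦ'U : ∀ k ∈ principalCongruenceLevel m K 𝔫₀, ∀ y : GL (Fin m) 𝔸,
      invQuot (AdelicGroupData.gl m K) Φ' (y * k) = invQuot (AdelicGroupData.gl m K) Φ' y)
    {S' : Set (HeightOneSpectrum (𝓞 K))} (hSS' : S ⊆ S') (hGood : ∀ v ∉ S', ¬ v.asIdeal ∣ 𝔫₀)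
    (τ : Fin m → ideleGroup K) (T : Fin n → ideleGroup K)
    (hTτ : ∀ i : Fin m, T (Fin.castLE hmn.le i) = τ i)
    (hTinf : GLn.toMixed n K (glDiagonal n 𝔸 T) = 1)
    (hTψ : ∀ v ∉ S', ∃ (d : Fin n → (v.adicCompletion K)ˣ) (a : (v.adicCompletion K)ˣ),
      localComponent v (glDiagonal n 𝔸 T) = diagonalGL (Fin n) (v.adicCompletion K) d ∧
      (∀ i j : Fin n, (i : ℕ) + 1 = j → (d i : v.adicCompletion K) * ((d j)⁻¹ : (v.adicCompletion K)ˣ) = a) ∧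
      (∀ c ∈ 𝒪[v.adicCompletion K], (adeleAddChar K).adicComponent v (a * c) = 1) ∧
      ∀ ϖ : v.adicCompletion K, Valued.v ϖ = WithZero.exp (-1 : ℤ) →
        ∃ c ∈ 𝒪[v.adicCompletion K], (adeleAddChar K).adicComponent v (a * (ϖ⁻¹ * c)) ≠ 1)
    (hτψ : ∀ v ∉ S', ∃ (d : Fin m → (v.adicCompletion K)ˣ) (a : (v.adicCompletion K)ˣ),
      localComponent v (glDiagonal m 𝔸 τ) = diagonalGL (Fin m) (v.adicCompletion K) d ∧
      (∀ i j : Fin m, (i : ℕ) + 1 = j → (d i : v.adicCompletion K) * ((d j)⁻¹ : (v.adicCompletion K)ˣ) = a) ∧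
      (∀ c ∈ 𝒪[v.adicCompletion K], (adeleAddChar K).adicComponent v (a * c) = 1) ∧
      ∀ ϖ : v.adicCompletion K, Valued.v ϖ = WithZero.exp (-1 : ℤ) →
        ∃ c ∈ 𝒪[v.adicCompletion K], (adeleAddChar K).adicComponent v (a * (ϖ⁻¹ * c)) ≠ 1)
    {x : HeightOneSpectrum (𝓞 K) → Fin n → ℂ} {y : HeightOneSpectrum (𝓞 K) → Fin m → ℂ}
    (hx : ∀ v ∉ S', (Finset.univ : Finset (Fin n)).val.map (x v) = α v)
    (hy : ∀ v ∉ S', (Finset.univ : Finset (Fin m)).val.map (y v) = γ v) :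
    ∃ (x₀ : ℝ) (J : ℂ → ℂ), Differentiable ℂ J ∧ ∀ s : ℂ, x₀ < s.re →
      J s = torusWeightC m K s τ *
          (partialPairL S' α (fun v => (γ v).map conj) (s + ((n : ℂ) - (m : ℂ)) / 2) *
            ∫ p in unitBox {v | v ∉ S'} ×ˢ Set.univ, torusPairIntegrandC m K
              (fun g => whittakerCoeff ν₀ (unipotentTateDomain n K) (adeleAddChar K)
                (invQuot (AdelicGroupData.gl n K) Φ) (glDiagonal n 𝔸 T * glCorner 𝔸 hmn.le g))
              (fun g => star (whittakerCoeff ν₀' (unipotentTateDomain m K) (adeleAddChar K)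
                (invQuot (AdelicGroupData.gl m K) Φ') (glDiagonal m 𝔸 τ * g)))
              (fun _ => (1 : ℝ)) s p ∂(νA.prod νK)) := by
  have hn : 0 < n := hm.trans hmn
  -- second countability / local compactness (measurability on the torus coordinates, s-finiteness)
  haveI : T2Space (GL (Fin m) 𝔸) := t2Space_gl m K
  haveI : LocallyCompactSpace (GL (Fin m) 𝔸) :=
    AdelicGroupData.locallyCompactSpace_generalLinearGroup_adeleRing K (Fin m)
  haveI : SecondCountableTopology (GL (Fin m) 𝔸) := secondCountableTopology_generalLinearGroup_adeleRing K (Fin m)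
  haveI : SecondCountableTopology (AdelicGroupData.gl m K).Adelic :=
    secondCountableTopology_generalLinearGroup_adeleRing K (Fin m)
  haveI : SecondCountableTopology ↥(maximalCompactAdelic m K) := TopologicalSpace.Subtype.secondCountableTopology _
  haveI := locallyCompactSpace_ideleGroup K
  haveI : CompactSpace ↥(maximalCompactAdelic m K) :=
    isCompact_iff_compactSpace.1 (isCompact_maximalCompactAdelic m K)
  haveI hν₀R : ν₀.IsMulRightInvariant := isMulRightInvariant_of_isHaarMeasure_adelicUnipotent ν₀
  haveI hν₀'R : ν₀'.IsMulRightInvariant := isMulRightInvariant_of_isHaarMeasure_adelicUnipotent ν₀'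
  -- Tate's character and boxes
  have hψ : IsGlobalAddChar K (adeleAddChar K) := isGlobalAddChar_adeleAddChar (K := K)
  have h𝓕 : IsFundamentalDomain ↥(rationalUnipotent n K) (unipotentTateDomain n K) ν₀ :=
    isFundamentalDomain_unipotentTateDomain ν₀
  have h𝓕' : IsFundamentalDomain ↥(rationalUnipotent m K) (unipotentTateDomain m K) ν₀' :=
    isFundamentalDomain_unipotentTateDomain ν₀'
  have h𝓕c : IsCompact (closure (unipotentTateDomain n K)) := isCompact_closure_unipotentTateDomain
  have h𝓕c' : IsCompact (closure (unipotentTateDomain m K)) := isCompact_closure_unipotentTateDomain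
  have h𝓕m : MeasurableSet (unipotentTateDomain n K) := measurableSet_unipotentTateDomain
  have h𝓕m' : MeasurableSet (unipotentTateDomain m K) := measurableSet_unipotentTateDomain
  -- the classical functions `φ`, `φ'` and their global Whittaker coefficients `W`, `W'`
  set φ : GL (Fin n) 𝔸 → ℂ := invQuot (AdelicGroupData.gl n K) Φ with hφdef
  set φ' : GL (Fin m) 𝔸 → ℂ := invQuot (AdelicGroupData.gl m K) Φ' with hφ'def
  have hφc : Continuous φ := hcusp.1.continuous_gl
  have hφ'c : Continuous φ' := hcusp'.1.continuous_gl
  have hφA : ∀ z ∈ (AdelicGroupData.gl n K).center', ∀ g : (AdelicGroupData.gl n K).Adelic,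
      φ (z * g) = φ g := fun z hz g => invQuot_mul_left _ Φ (Subgroup.mem_sup_left hz) g
  have hφ'A : ∀ z ∈ (AdelicGroupData.gl m K).center', ∀ g : (AdelicGroupData.gl m K).Adelic,
      φ' (z * g) = φ' g := fun z hz g => invQuot_mul_left _ Φ' (Subgroup.mem_sup_left hz) g
  set W : GL (Fin n) 𝔸 → ℂ := whittakerCoeff ν₀ (unipotentTateDomain n K) (adeleAddChar K) φ with hWdef
  set W' : GL (Fin m) 𝔸 → ℂ := whittakerCoeff ν₀' (unipotentTateDomain m K) (adeleAddChar K) φ' with hW'def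
  have hWc : Continuous W := continuous_whittakerCoeff h𝓕m h𝓕c hψ.continuous hφc
  have hW'c : Continuous W' := continuous_whittakerCoeff h𝓕m' h𝓕c' hψ.continuous hφ'c
  -- the torus element `D = diag(1_m, T_m, …, T_{n-1})` and the right translate `r(D) φ`
  set D : Fin n → ideleGroup K := fun i => if (i : ℕ) < m then 1 else T i with hDdef
  have hD₁ : ∀ i : Fin n, (i : ℕ) < m → D i = 1 := fun i hi => by simp only [hDdef, if_pos hi]
  have hD₂ : ∀ i : Fin n, m ≤ (i : ℕ) → D i = T i := fun i hi => by simp only [hDdef, if_neg (not_lt.2 hi)]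
  set Dg : GL (Fin n) 𝔸 := glDiagonal n 𝔸 D with hDg
  -- the same element read in the tree's adelic group type (definitionally `GL_n(𝔸_K)`)
  let DgA : (AdelicGroupData.gl n K).Adelic := Dg
  have hTD : glCorner 𝔸 hmn.le (glDiagonal m 𝔸 τ) * Dg = glDiagonal n 𝔸 T :=
    glCorner_glDiagonal_mul_glDiagonal_eq hmn.le τ T D hTτ hD₁ hD₂
  have hDcomm : ∀ g : GL (Fin m) 𝔸, Dg * glCorner 𝔸 hmn.le g = glCorner 𝔸 hmn.le g * Dg := fun g =>
    glDiagonal_mul_glCorner_comm hmn.le D hD₁ g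
  -- `D` is finite-adelic: its archimedean part is `1` since that of `T` is
  have hTinf' : ∀ i : Fin n, ((T i : ideleGroup K) : 𝔸).1 = 1 := fst_apply_eq_one_of_toMixed_glDiagonal T hTinf
  have hDinf : ∀ i : Fin n, ((D i : ideleGroup K) : 𝔸).1 = 1 := fun i => by
    by_cases hi : (i : ℕ) < m
    · rw [hD₁ i hi]; rfl
    · rw [hD₂ i (not_lt.1 hi)]; exact hTinf' i
  have hDfin : DgA ∈ (AutomorphyDatum.gl n K (isCompact_glFiniteIntegralLevel_holds n K)).finiteAdelic :=
    glDiagonal_mem_range_ofFinite D hDinf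
  set φD : (AdelicGroupData.gl n K).Adelic → ℂ := rightTranslation (AdelicGroupData.gl n K) DgA φ with hφDdef
  have hφDapp : ∀ g : (AdelicGroupData.gl n K).Adelic, φD g = φ (g * DgA) := fun g => rfl
  have hφDcusp : IsCuspFormGL n K (isCompact_glFiniteIntegralLevel_holds n K) φD :=
    hcusp.rightTranslation_gl hDfin
  have hφDA : ∀ z ∈ (AdelicGroupData.gl n K).center', ∀ g : (AdelicGroupData.gl n K).Adelic,
      φD (z * g) = φD g := fun z hz g => by
    rw [hφDapp, hφDapp, mul_assoc]
    exact hφA z hz (g * DgA)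
  have hφDc : Continuous φD := by
    have h : Continuous fun g : (AdelicGroupData.gl n K).Adelic => φ (g * DgA) :=
      hφc.comp (continuous_id.mul continuous_const)
    exact h
  set WD : GL (Fin n) 𝔸 → ℂ := whittakerCoeff ν₀ (unipotentTateDomain n K) (adeleAddChar K) φD with hWDdef
  have hWD : ∀ g : GL (Fin n) 𝔸, WD g = W (g * Dg) := fun g =>
    (whittakerCoeff_mul_right (ν := ν₀) (𝓕 := unipotentTateDomain n K) (ψ := adeleAddChar K) φ g Dg).symm
  have hWDc : Continuous WD := continuous_whittakerCoeff h𝓕m h𝓕c hψ.continuous hφDc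
  -- the bridge `Φ_0 = W_Φ` for `φD`
  have hW₀ : ∀ g, whittakerDepth 0 φD g = WD g := fun g =>
    whittakerDepth_zero_eq_whittakerCoeff hφDc hn ν₀ g
  -- `W'` is bounded
  obtain ⟨M, hM⟩ := hcusp'.bounded_of_center' hφ'A
  have hM0 : 0 ≤ M := (norm_nonneg _).trans (hM 1)
  have hW₀' : ∀ g, whittakerDepth 0 φ' g = W' g := fun g =>
    whittakerDepth_zero_eq_whittakerCoeff hφ'c hm ν₀' g
  have hW'b : ∀ g, ‖W' g‖ ≤ M := fun g => by rw [← hW₀' g]; exact norm_whittakerDepth_le hM 0 g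
  -- (E) the analytic clause at `(r(D) φ, φ')`: the entire `J`
  obtain ⟨x₁, J, hJd, hJ⟩ := hE hφDcusp hcusp' hφDA hφ'A
  -- (Ac) one-factor absolute convergence at `r(D) φ` beyond `σ₀`
  obtain ⟨σ₀, hσ₀⟩ := hAbs hφDcusp hφDA
  -- the shift and the right half-plane
  set sh : ℂ := ((n : ℂ) - (m : ℂ)) / 2 with hsh
  refine ⟨max (max x₁ σ₀) (|sh.re| + 1), J, hJd, fun s hs => ?_⟩
  have hsx : x₁ < s.re := lt_of_le_of_lt ((le_max_left _ _).trans (le_max_left _ _)) hs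
  have hsσ : σ₀ ≤ s.re := (le_max_right _ _).trans ((le_max_left _ _).trans hs.le)
  have hssh : |sh.re| + 1 < s.re := lt_of_le_of_lt (le_max_right _ _) hs
  have hs' : 1 / 2 < s.re := by linarith [abs_nonneg sh.re]
  have hs1 : 1 < (s + sh).re := by
    have h : -|sh.re| ≤ sh.re := neg_abs_le _
    rw [Complex.add_re]; linarith
  -- (1) the entire function at `s`
  have hJs := hJ s hsx
  -- (2) the unfolded integrand at `(r(D) φ, φ')` and its integrability
  set I₁ : (Fin m → ideleGroup K) × ↥(maximalCompactAdelic m K) → ℂ := torusPairIntegrandC m K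
    (fun g => WD (glCorner 𝔸 hmn.le g)) (fun g => star (W' g)) (fun _ => (1 : ℝ)) s with hI₁
  have hfinW : ∫⁻ p, ‖WD (glCorner 𝔸 hmn.le (torusPoint m K p))‖ₑ *
      ENNReal.ofReal (torusWeight m K s.re p.1) ∂(νA.prod νK) < ⊤ := by
    simpa only [hW₀] using hσ₀ s.re hsσ
  have hint₁ : Integrable I₁ (νA.prod νK) := integrable_pair_of_lintegral hmn.le νA νK hWDc hW'c hM0 hW'b hfinW
  -- (3) the torus substitution `a ↦ τ a`, then `W_{r(D)φ}(ι(τ g)) = W(diag(T) ι(g))`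
  have htr := integral_torusPairIntegrandC_translate νA νK (fun g => WD (glCorner 𝔸 hmn.le g))
    (fun g => star (W' g)) τ s
  have hintτ := integrable_torusPairIntegrandC_translate νA νK (fun g => WD (glCorner 𝔸 hmn.le g))
    (fun g => star (W' g)) τ hint₁
  beta_reduce at htr hintτ
  have hWT : ∀ g : GL (Fin m) 𝔸,
      WD (glCorner 𝔸 hmn.le (glDiagonal m 𝔸 τ * g)) = W (glDiagonal n 𝔸 T * glCorner 𝔸 hmn.le g) := fun g => by
    rw [hWD, map_mul, mul_assoc, ← hDcomm g, ← mul_assoc, hTD]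
  have hfun : (torusPairIntegrandC m K (fun g => WD (glCorner 𝔸 hmn.le (glDiagonal m 𝔸 τ * g)))
      (fun g => star (W' (glDiagonal m 𝔸 τ * g))) (fun _ => (1 : ℝ)) s) =
      torusPairIntegrandC m K (fun g => W (glDiagonal n 𝔸 T * glCorner 𝔸 hmn.le g))
        (fun g => star (W' (glDiagonal m 𝔸 τ * g))) (fun _ => (1 : ℝ)) s := by
    funext p
    simp only [torusPairIntegrandC, hWT]
  rw [hfun] at htr hintτ
  -- (4) the honest translated unramified data at every `v ∉ S'`
  have hSv : ∀ v ∉ S', v ∉ S := fun v hv h => hv (hSS' h)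
  have hex : ∀ v ∉ S', ∃ ϖ : (v.adicCompletion K)ˣ, IsTorusUnramifiedAt n K
      (fun g => W (glDiagonal n 𝔸 T * g)) v ϖ (x v) := fun v hv => by
    obtain ⟨d, a, hT, hd, hψa, hψa'⟩ := hTψ v hv
    exact HonestTranslateUnramified.exists_isTorusUnramifiedAt_whittakerCoeff_of_ae_eq_translate P hα h𝔫₀
      (hSv v hv) (hGood v hv) hΦc sv hae hΦU (hx v hv) h𝓕 h𝓕c hψ hT hd hψa hψa'
  have hex' : ∀ v ∉ S', ∃ ϖ : (v.adicCompletion K)ˣ, IsTorusUnramifiedAt m K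
      (fun g => W' (glDiagonal m 𝔸 τ * g)) v ϖ (y v) := fun v hv => by
    obtain ⟨d, a, hT, hd, hψa, hψa'⟩ := hτψ v hv
    exact HonestTranslateUnramified.exists_isTorusUnramifiedAt_whittakerCoeff_of_ae_eq_translate Q hγ h𝔫₀
      (hSv v hv) (hGood v hv) hΦ'c sv' hae' hΦ'U (hy v hv) h𝓕' h𝓕c' hψ hT hd hψa hψa'
  let ϖ : ∀ v : HeightOneSpectrum (𝓞 K), (v.adicCompletion K)ˣ := fun v =>
    if hv : v ∉ S' then Classical.choose (hex v hv) else 1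
  have hWu : ∀ v ∉ S', IsTorusUnramifiedAt n K (fun g => W (glDiagonal n 𝔸 T * g)) v (ϖ v) (x v) :=
    fun v hv => by
    simp only [ϖ, dif_pos hv]
    exact Classical.choose_spec (hex v hv)
  have hW'u : ∀ v ∉ S', IsTorusUnramifiedAt m K (fun g => star (W' (glDiagonal m 𝔸 τ * g))) v (ϖ v)
      (star (y v)) := fun v hv => by
    obtain ⟨ϖ', hϖ'⟩ := hex' v hv
    exact (hϖ'.of_valued_eq (hWu v hv).valued_eq).star
  -- the central character of `π`: `‖W^T‖` is central-invariant
  have hΦ2 : MemLp Φ 2 μ := (Lp.memLp (sv : (AdelicGroupData.gl n K).L2 μ)).ae_eq hae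
  have hsvP : hΦ2.toLp Φ ∈ P.1 := by
    have h : hΦ2.toLp Φ = (sv : (AdelicGroupData.gl n K).L2 μ) := Lp.ext (hΦ2.coeFn_toLp.trans hae.symm)
    rw [h]
    exact ContRepresentation.ClosedSubrep.mem_toSubmodule.1 sv.2
  obtain ⟨ωP, hu, -, hcl⟩ := exists_centralCharacter_invQuot P hΦc hΦ2 hsvP
  have hWZ0 : ∀ (z : ideleGroup K) (g : GL (Fin n) 𝔸),
      ‖W (Matrix.GeneralLinearGroup.scalar (Fin n) z * g)‖ = ‖W g‖ := fun z g => by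
    rw [hWdef, whittakerCoeff_scalar_mul (fun g' => hcl z g') g, norm_mul, hu z, one_mul]
  have hWZ : ∀ (z : ideleGroup K) (g : GL (Fin n) 𝔸),
      ‖W (glDiagonal n 𝔸 T * (Matrix.GeneralLinearGroup.scalar (Fin n) z * g))‖ = ‖W (glDiagonal n 𝔸 T * g)‖ :=
    norm_translate_scalar_mul T hWZ0
  -- the Satake bounds `‖x_v i‖, ‖y_v a‖ ≤ q_v^{1/2}`
  have hxb : ∀ v ∉ S', ∀ i, ‖x v i‖ ≤ (v.residueCard : ℝ) ^ (1 / 2 : ℝ) := fun v hv i => by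
    rw [← Real.sqrt_eq_rpow]
    exact norm_satakeParameter_le_sqrt_holds P hα (hSv v hv)
      (by rw [← hx v hv]; exact Multiset.mem_map_of_mem _ (Finset.mem_univ_val _))
  have hyb : ∀ v ∉ S', ∀ a, ‖star (y v) a‖ ≤ (v.residueCard : ℝ) ^ (1 / 2 : ℝ) := fun v hv a => by
    rw [Pi.star_apply, norm_star, ← Real.sqrt_eq_rpow]
    exact norm_satakeParameter_le_sqrt_holds Q hγ (hSv v hv)
      (by rw [← hy v hv]; exact Multiset.mem_map_of_mem _ (Finset.mem_univ_val _))
  -- (5) the Euler factorisation at the torus parameter `s`, the Euler product at `s + sh`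
  have hy' : ∀ v ∉ S', (Finset.univ : Finset (Fin m)).val.map (star (y v)) = (γ v).map conj := fun v hv => by
    rw [← hy v hv, Multiset.map_map]
    rfl
  have hL := hasProd_partialPairL JacquetShalika1981_multipliable_partialPairL_holds P Q.conj (hα.mono hSS')
    (hγ.mono hSS').conj hs1
  have heul := hEul (W := fun g => W (glDiagonal n 𝔸 T * g)) (W' := fun g => star (W' (glDiagonal m 𝔸 τ * g)))
    (hWc.comp (continuous_const_mul _)) (hW'c.comp (continuous_const_mul _)).star hWZ hWu hW'u hxb hyb s hs'
    hintτ (β := fun v => (γ v).map conj) hx hy' hL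
  beta_reduce at heul
  -- assembly
  calc J s = ∫ p, I₁ p ∂(νA.prod νK) := by rw [hJs]
    _ = torusWeightC m K s τ * ∫ p, torusPairIntegrandC m K
          (fun g => W (glDiagonal n 𝔸 T * glCorner 𝔸 hmn.le g))
          (fun g => star (W' (glDiagonal m 𝔸 τ * g))) (fun _ => (1 : ℝ)) s p ∂(νA.prod νK) := by
        rw [hI₁, htr]
    _ = _ := by rw [heul]

end Main


end Summit.Langlands.Langlands.Theorems.GapGlobalTranslate

end
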